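import Summits.FinalStateConjecture.FinalStateConjecture.Theorems.GapExhaustion.Negative.GapExhaustionFalseOfFarWildBlackHole

/-!
# Crux `GapExhaustion` (stmt-FinalStateConjecture-10808), line `Sketch`: the lead stub
# `stub_lateCollaredLeaves` (A⁺) is false on a far-wild black-hole development

Line `Sketch` (`Cruxes/GapExhaustion/Lines/Sketch.lean`, registered skeleton sha `9c560ad4…`) composes
`GapExhaustion` from four stubs; the lead stub (A⁺) `stub_lateCollaredLeaves` asserts, for EVERY
maximal vacuum Cauchy development of admissible data with complete `𝓘⁺` and a collar margin, a mass
window `m₀` and a margin `χ < 1` such that for every leaf order `k` some finite `Λ` works: for every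
collar order `k'`, closeness `δ > 0`, budget `ε > 0` and compact `K` there is a late `(Λ,k)`-leaf `S`
beyond `J⁻(K)` with `N ≤ 1` thick collar charts `δ`-close in `C^{k'}` to boosted Kerr (slabs inside
`S`, probe point in every collar) and — in the collar-free branch `N = 0` — a cut Bondi energy
`≤ ε` of the cone of the probe point.

This file proves that (A⁺) FAILS on any development carrying the first two witnesses of the
construction hypothesis `FarWildBlackHoleExists` of
`GapExhaustionFalseOfFarWildBlackHole.lean` (line lead c2, p108531):

* (W) beyond `J⁻(K₁)` no thick collar chart of any label is `δ₁`-close in `C³` to boosted Kerr —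
  so the development HAS a collar margin (`collarMargin_of_noQuietCollar`) and (A⁺) owes its
  conclusion, while at collar order `k' = 3`, `δ = δ₁` no collar can be reported: `N = 0`;
* (F) every cut Bondi energy of the cone of every point outside `J⁻(K₂)` is `≥ μ > 0` — so the
  `N = 0` clause `HasCutBondiMass {p} m ∧ m ≤ ε` fails at `ε = μ/2` for the late probe point.

The competitor witness (C) of `FarWildBlackHoleExists` is NOT used: the lead stub dies on a strictly
weaker hypothesis than the crux does (`lateCollaredLeaves_false_of_noQuietCollar_floor`, binder
form over one development; `stub_lateCollaredLeaves_false_of_farWildBlackHoleExists`, packaged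
against the verbatim registered stub signature). Since the composed
target is false on the same developments (`GapExhaustion_false_of_farWildBlackHoleExists`), no
reshape of the stub set keeps a composition: the line is dead modulo `H`
(`Cruxes/GapExhaustion/Lines/Sketch.dead.md`). A NEGATIVE LEMMA MODULO `H`, not a refutation.

Line lead `prover-line-stmt-FinalStateConjecture-10808-c5-0`, 2026-08-16.
-/

noncomputable section

-- D-0017: single-problem summit, `Summit.<S>.<S>.…` by design (cf. lakefile `weak.linter.dupNamespace`).
set_option linter.dupNamespace false

open Set
open scoped Manifold ENNReal ContDiff Topology

namespace Summit.FinalStateConjecture.FinalStateConjecture.Theorems.GapExhaustion.Negative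

open Literature.Geometry.Lorentzian

/-- **(A⁺) fails on one development with (W) and (F)** (binder form). Let `𝒟` be a vacuum Cauchy
development such that (W) beyond `J⁻(K₁)` no thick collar chart of any label `0 < M₁`,
`|a₁| ≤ M₁` is `δ₁`-close in `C³` to boosted Kerr and (F) every cut Bondi energy of the cone of
every point outside `J⁻(K₂)` is `≥ μ > 0`. Then the conclusion of (A⁺) for `𝒟` — a window `m₀`,
a margin `χ < 1` and, for every leaf order `k`, a finite `Λ` such that for every collar order `k'`,
closeness `δ`, budget `ε` and compact `K` there is a late `(Λ,k)`-leaf with `N ≤ 1` thick collars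
`δ`-close in `C^{k'}` (slabs in the leaf, probe point in every collar) and, if `N = 0`, a point-cone
energy `≤ ε` — is absurd: at `k = 0`, `k' = 3`, `δ = δ₁`, `ε = μ/2`, `K = K₁ ∪ K₂` a reported
collar would be a late `C³`-`δ₁`-quiet thick collar chart of label `M ≥ m₀ > 0`, `|a| ≤ χM ≤ M`
(excluded by (W)), and in the collar-free branch the probe point `p ∈ S`, `J⁺(S) ∩ J⁻(K₂) = ∅`,
would carry a point-cone energy `≤ μ/2 < μ` (excluded by (F)). (W) is exactly what makes the
collar-margin HYPOTHESIS of (A⁺) hold for `𝒟` (`collarMargin_of_noQuietCollar`), so this is a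
failure of the stub's conclusion, not a vacuity. [folklore] -/
theorem lateCollaredLeaves_false_of_noQuietCollar_floor {X : Type} [TopologicalSpace X]
    [ChartedSpace E3 X] [IsManifold (𝓡 3) ∞ X] [ConnectedSpace X] {D : InitialDataSet (𝓡 3) X}
    (𝒟 : VacuumCauchyDevelopment D)
    (δ₁ : ℝ≥0∞) (K₁ : Set 𝒟.carrier) (hδ₁ : 0 < δ₁) (hK₁ : IsCompact K₁)
    (hwild : ∀ (M₁ a₁ : ℝ) (mo₁ : lorentzGroup × E4) (B₁ : ModelBackground)
      (Φ₁ : B₁.domain → 𝒟.carrier), 0 < M₁ → |a₁| ≤ M₁ →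
      B₁ = starBackground mo₁.1 mo₁.2 M₁ a₁
        (fun x => Kerr.radius a₁ (poincareInv mo₁.1 mo₁.2 x)) →
      ContMDiffOn 𝓘(ℝ, E4) (𝓡 4) ∞ Φ₁
        {x | -1 < B₁.time x.1 ∧ B₁.time x.1 < 1 ∧ B₁.radius x.1 < 3 * M₁ + 1} →
      Topology.IsOpenEmbedding
        ({x | -1 < B₁.time x.1 ∧ B₁.time x.1 < 1 ∧ B₁.radius x.1 < 3 * M₁ + 1}.restrict Φ₁) →
      𝒟.toSpacetime.truncDeviationCk B₁ Φ₁ 3 (3 * M₁) 0 ≤ δ₁ →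
      Disjoint (Φ₁ '' B₁.truncTimeSlab (3 * M₁) 0)
        (𝒟.metric.causalPast 𝒟.timeOrientation K₁) → False)
    (μ : ℝ) (K₂ : Set 𝒟.carrier) (hμ : 0 < μ) (hK₂ : IsCompact K₂)
    (hfloor : ∀ p : 𝒟.carrier, p ∉ 𝒟.metric.causalPast 𝒟.timeOrientation K₂ →
      ∀ m : ℝ, 𝒟.toCauchyDevelopment.HasCutBondiMass {p} m → μ ≤ m)
    (hA : ∃ (m₀ χ : ℝ), 0 < m₀ ∧ χ < 1 ∧ ∀ k : ℕ, ∃ Λ : ℝ≥0∞, Λ < ⊤ ∧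
        ∀ (k' : ℕ) (δ : ℝ≥0∞) (ε : ℝ), 0 < δ → 0 < ε → ∀ K : Set 𝒟.carrier, IsCompact K →
          ∃ (N : ℕ) (M a : Fin N → ℝ) (S : Set 𝒟.carrier) (p : 𝒟.carrier)
            (mo : Fin N → lorentzGroup × E4) (B : Fin N → ModelBackground)
            (Φ : ∀ i, (B i).domain → 𝒟.carrier),
            N ≤ 1 ∧ (∀ i, m₀ ≤ M i ∧ M i ≤ m₀⁻¹ ∧ |a i| ≤ χ * M i) ∧
              𝒟.toCauchyDevelopment.IsNearKerrLeaf k Λ N M a S ∧ p ∈ S ∧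
              Disjoint (𝒟.metric.causalFuture 𝒟.timeOrientation S)
                (𝒟.metric.causalPast 𝒟.timeOrientation K) ∧
              (∀ i, B i = starBackground (mo i).1 (mo i).2 (M i) (a i)
                (fun x => Kerr.radius (a i) (poincareInv (mo i).1 (mo i).2 x))) ∧
              (∀ i, ContMDiffOn 𝓘(ℝ, E4) (𝓡 4) ∞ (Φ i)
                  {x | -1 < (B i).time x.1 ∧ (B i).time x.1 < 1 ∧
                    (B i).radius x.1 < 3 * M i + 1} ∧
                Topology.IsOpenEmbedding
                  ({x | -1 < (B i).time x.1 ∧ (B i).time x.1 < 1 ∧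
                      (B i).radius x.1 < 3 * M i + 1}.restrict (Φ i))) ∧
              (∀ i, 𝒟.toSpacetime.truncDeviationCk (B i) (Φ i) k' (3 * M i) 0 ≤ δ) ∧
              (∀ i, Φ i '' (B i).truncTimeSlab (3 * M i) 0 ⊆ S) ∧
              (∀ i, p ∈ Φ i '' (B i).truncTimeSlab (3 * M i) 0) ∧
              (N = 0 → ∃ m : ℝ, 𝒟.toCauchyDevelopment.HasCutBondiMass {p} m ∧ m ≤ ε)) :
    False := by
  obtain ⟨m₀, χ, hm₀, hχ, hall⟩ := hA
  obtain ⟨Λ, -, hall⟩ := hall 0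
  have hμ2 : 0 < μ / 2 := by positivity
  obtain ⟨N, M, a, S, p, mo, B, Φ, -, hwin, -, hp, hlate, hB, hΦ, hdev, hS, -, hN0⟩ :=
    hall 3 δ₁ (μ / 2) hδ₁ hμ2 (K₁ ∪ K₂) (hK₁.union hK₂)
  have hlate₁ : Disjoint (𝒟.metric.causalFuture 𝒟.timeOrientation S)
      (𝒟.metric.causalPast 𝒟.timeOrientation K₁) :=
    hlate.mono_right (LorentzianMetric.causalFuture_mono subset_union_left)
  have hlate₂ : Disjoint (𝒟.metric.causalFuture 𝒟.timeOrientation S)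
      (𝒟.metric.causalPast 𝒟.timeOrientation K₂) :=
    hlate.mono_right (LorentzianMetric.causalFuture_mono subset_union_right)
  rcases Nat.eq_zero_or_pos N with rfl | hNpos
  · -- no collar: the probe point's cone must be light, against the floor (F)
    have hpK₂ : p ∉ 𝒟.metric.causalPast 𝒟.timeOrientation K₂ := fun hpK =>
      Set.disjoint_left.1 hlate₂ (LorentzianMetric.subset_causalFuture _ _ _ hp) hpK
    obtain ⟨m, hm, hmε⟩ := hN0 rfl
    have hμm : μ ≤ m := hfloor p hpK₂ m hm
    linarith
  · -- a collar: a `C³`-`δ₁`-quiet late thick collar chart, excluded by (W)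
    set i : Fin N := ⟨0, hNpos⟩
    have hMi : 0 < M i := hm₀.trans_le (hwin i).1
    have hai : |a i| ≤ M i := (hwin i).2.2.trans (mul_le_of_le_one_left hMi.le hχ.le)
    have hcol : Disjoint (Φ i '' (B i).truncTimeSlab (3 * M i) 0)
        (𝒟.metric.causalPast 𝒟.timeOrientation K₁) :=
      hlate₁.mono_left ((hS i).trans (LorentzianMetric.subset_causalFuture _ _ _))
    exact hwild (M i) (a i) (mo i) (B i) (Φ i) hMi hai (hB i) (hΦ i).1 (hΦ i).2 (hdev i) hcol

/-- **Negative lemma modulo `FarWildBlackHoleExists` for the lead stub of line `Sketch`.** One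
far-wild black-hole development falsifies (A⁺) — stated here with the verbatim registered
signature of `Summit.FinalStateConjecture.FinalStateConjecture.Cruxes.GapExhaustion.Sketch.stub_lateCollaredLeaves`
(skeleton sha `9c560ad4…`) under the negation; only the witnesses (W) and (F) of `H` are used,
the competitor witness (C) is idle. [folklore] -/
theorem stub_lateCollaredLeaves_false_of_farWildBlackHoleExists (H : FarWildBlackHoleExists) :
    ¬ (∀ (X : Type) [TopologicalSpace X] [ChartedSpace E3 X] [IsManifold (𝓡 3) ∞ X] [T2Space X]
      [SecondCountableTopology X] [ConnectedSpace X], ∀ D ∈ admissibleVacuumData X,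
      ∀ 𝒟 : VacuumCauchyDevelopment D, 𝒟.IsMaximal →
        Summit.FinalStateConjecture.HasCompleteNullInfinity 𝒟.toCauchyDevelopment →
        𝒟.CollarMargin →
        ∃ (m₀ χ : ℝ), 0 < m₀ ∧ χ < 1 ∧ ∀ k : ℕ, ∃ Λ : ℝ≥0∞, Λ < ⊤ ∧
          ∀ (k' : ℕ) (δ : ℝ≥0∞) (ε : ℝ), 0 < δ → 0 < ε → ∀ K : Set 𝒟.carrier, IsCompact K →
            ∃ (N : ℕ) (M a : Fin N → ℝ) (S : Set 𝒟.carrier) (p : 𝒟.carrier)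
              (mo : Fin N → lorentzGroup × E4) (B : Fin N → ModelBackground)
              (Φ : ∀ i, (B i).domain → 𝒟.carrier),
              N ≤ 1 ∧ (∀ i, m₀ ≤ M i ∧ M i ≤ m₀⁻¹ ∧ |a i| ≤ χ * M i) ∧
                𝒟.toCauchyDevelopment.IsNearKerrLeaf k Λ N M a S ∧ p ∈ S ∧
                Disjoint (𝒟.metric.causalFuture 𝒟.timeOrientation S)
                  (𝒟.metric.causalPast 𝒟.timeOrientation K) ∧
                (∀ i, B i = starBackground (mo i).1 (mo i).2 (M i) (a i)
                  (fun x => Kerr.radius (a i) (poincareInv (mo i).1 (mo i).2 x))) ∧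
                (∀ i, ContMDiffOn 𝓘(ℝ, E4) (𝓡 4) ∞ (Φ i)
                    {x | -1 < (B i).time x.1 ∧ (B i).time x.1 < 1 ∧
                      (B i).radius x.1 < 3 * M i + 1} ∧
                  Topology.IsOpenEmbedding
                    ({x | -1 < (B i).time x.1 ∧ (B i).time x.1 < 1 ∧
                        (B i).radius x.1 < 3 * M i + 1}.restrict (Φ i))) ∧
                (∀ i, 𝒟.toSpacetime.truncDeviationCk (B i) (Φ i) k' (3 * M i) 0 ≤ δ) ∧
                (∀ i, Φ i '' (B i).truncTimeSlab (3 * M i) 0 ⊆ S) ∧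
                (∀ i, p ∈ Φ i '' (B i).truncTimeSlab (3 * M i) 0) ∧
                (N = 0 → ∃ m : ℝ, 𝒟.toCauchyDevelopment.HasCutBondiMass {p} m ∧ m ≤ ε)) := by
  intro hA
  obtain ⟨X, _, _, _, _, _, _, D, hD, 𝒟, hmax, hcni, δ₁, K₁, μ, K₂, hδ₁, hK₁, hμ, hK₂, hwild,
    hfloor, -⟩ := H
  exact lateCollaredLeaves_false_of_noQuietCollar_floor 𝒟 δ₁ K₁ hδ₁ hK₁ hwild μ K₂ hμ hK₂ hfloor
    (hA X D hD 𝒟 hmax hcni (collarMargin_of_noQuietCollar 𝒟.toSpacetime δ₁ K₁ hδ₁ hK₁ hwild))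

end Summit.FinalStateConjecture.FinalStateConjecture.Theorems.GapExhaustion.Negative

end
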